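import Literature.AnabelianGeometry.EtaleTheta.Discharge.Sec3Cor38iiiFSM
import Literature.AnabelianGeometry.EtaleTheta.Discharge.Sec3RealifiedCuspidal
import Literature.AnabelianGeometry.EtaleTheta.DivisorMonoidsCuspidal
import HarnessLib

/-!
# [EtTh] Cor. 3.8 (iii), pre-steps: the Def. 3.1 / 3.6 (iii) data axioms DISCHARGED for THE realified
# divisor monoids `Φ₀^ℝ := Φ₀^rlf` (`ofRlfZ` / `ofRlfR`)

Mochizuki, *The étale theta function …*, Publ. RIMS **45** (2009), Def. 3.1 (i) p.70 (non-cuspidal /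
cuspidal log-divisors), Def. 3.6 (iii) p.77 ("an element of `Φ(A)` is non-cuspidal (respectively,
cuspidal) if it arises … from a non-cuspidal (respectively, cuspidal) log-divisor … a prime … is
non-cuspidal (respectively, cuspidal) if it contains a [non-zero] non-cuspidal (respectively, cuspidal) element of the monoid
`Φ(A)`"), Cor. 3.8 (iii) pp.80–82 [cite: MochizukiEtTh2009, Def 3.6 p.77]
[cite: MochizukiEtTh2009, Cor 3.8 p.81].

abc-iut cell, seat abc-iut-L2-d2, node EtTh:Cor3.8(iii).  `Sec3Cor38iii.cor38_iii_of` /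
`Sec3Cor38iiiFSM.cor38_iii_of_isOfFSMType` prove the pre-step clause of Cor. 3.8 (iii) for tempered
Frobenioids over ANY realified divisor-monoid data `T`, taking as binders four properties of the
non-cuspidal / cuspidal parts that abc-iut-L2-t3's interface `RealifiedDivisorMonoids` does not record
(`hD1` base-field-theoretic ⇒ non-cuspidal, `hDa` non-cuspidal ∧ cuspidal ⇒ trivial, `hDn`/`hDc` "`x` is
(non-)cuspidal iff every primary `y ≼ x` is").  THIS FILE discharges `hDa` outright and `hDn`, `hDc` up
to ONE transparent hypothesis for the STANDARD data `T = ofRlfZ dm hpf` (abc-iut-L6-t12: `Φ₀^ℝ(Y) :=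
Φ₀(Y)^rlf`, (non-)cuspidal part := elements supported in the primes of the (non-)cuspidal log-divisors):
* `DivisorMonoids.disjoint_supp_of_mem_ncsp₀_of_mem_csp₀`: a non-cuspidal and a cuspidal log-divisor have
  DISJOINT supports in `Φ₀(Y)^rlf` (Def. 3.1 (i): a prime log-divisor is a special-fibre component or a
  cusp, never both — from the unique factorisation `existsUnique_ncsp_csp` via
  `exists_isPrimary_precsim_of_factorMap_ne_one`), hence `ofRlfZ_disjoint_toRSuppOf` and (`hDa`)
  `TemperedFrobenioid.eq_one_of_isNonCuspidal_of_isCuspidal`;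
* (`hDn`/`hDc`, ⇒) `isNonCuspidal_of_precsim` / `isCuspidal_of_precsim` (down-closure under `≼`, from
  abc-iut-L6-t12's `ofRlfZ_ncspR_of_dvd` / root-closedness);
* (`hDn`/`hDc`, ⇐) from the hypothesis **(R3) "no phantom support"**: every prime in the support of
  `x ∈ Φ(A)` lies in the support of some primary `y ≼ x` of `Φ(A)` — TRUE for the intended `Φ` (finitely
  or countably many prime log-divisors under each element) but NOT a consequence of the interface (a
  group-saturated weakly perf-factorial `P ⊆ ∏ ℝ≥0` built from an ultrafilter limit violates it; seat notes
  R3), so it is carried by name (`iii_iff_primaries_of_noPhantom`);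
and assembles `cor38_iii_ofRlfZ` / `cor38_iii_ofRlfZ_of_isOfFSMType`: Cor. 3.8 (iii) (pre-steps) for
tempered Frobenioids over `ofRlfZ` data with the remaining named inputs [FrdI] Thm. 3.4 (ii)/(iii) resp.
`IsFrobenioid` + FSM-type, [FrdI] Thm. 4.2 (i) (`hprim`), `hD1` (abc-iut-L2-t3's forthcoming `cnst ⊆ ncsp`
datum) and (R3).  HONEST FRAMING: classical theory of tempered Frobenioids; nothing here bears on
[IUTchIII] Cor. 3.12.
-/

namespace Literature.AnabelianGeometry.EtaleTheta

open CategoryTheory Opposite Literature.AlgebraicGeometry.Frobenioids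

universe u₀ v₀ u v w

/-! ### `Φ₀`-level: non-cuspidal and cuspidal log-divisors have disjoint supports -/

namespace DivisorMonoids

variable {D₀ : Type u₀} [Category.{v₀} D₀] (T : DivisorMonoids.{u₀, v₀, w} D₀) (Y : D₀ᵒᵖ)

/-- **Def. 3.1 (i): a prime log-divisor is either a special-fibre component or a cusp** — for perf-factorial
`Φ₀(Y)`, the images in `Φ₀(Y)^rlf_factor` of a non-cuspidal `a` and a cuspidal `c` have disjoint supports:
a prime in both supports contains primaries `m ≼ a`, `m' ≼ c` with `m ≼ m'`, so `m` is non-cuspidal and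
cuspidal, i.e. `m = 0`. [cite: MochizukiEtTh2009, Def 3.1 p.70] -/
theorem disjoint_supp_of_mem_ncsp₀_of_mem_csp₀ (hpf : IsPerfFactorial (T.Φ₀.obj Y)) {a c : T.Φ₀.obj Y}
    (ha : a ∈ T.ncsp₀ Y) (hc : c ∈ T.csp₀ Y) :
    Disjoint (supp (factorMap _ (Perfection.of _ a))) (supp (factorMap _ (Perfection.of _ c))) := by
  have hS : IsSharp (T.Φ₀.obj Y) := hpf.isDivisorial.isSharp
  refine Set.disjoint_left.2 fun 𝔮 h𝔮a h𝔮c => ?_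
  obtain ⟨m, hm, hm𝔮, hma⟩ := hpf.exists_isPrimary_precsim_of_factorMap_ne_one h𝔮a
  obtain ⟨m', -, hm'𝔮, hm'c⟩ := hpf.exists_isPrimary_precsim_of_factorMap_ne_one h𝔮c
  have hmm' : Precsim m m' := Perfection.of_precsim_of_iff.1 (Primes.precsim_of_mem_carrier 𝔮 hm𝔮 hm'𝔮)
  exact hm.1 (T.eq_one_of_mem_ncsp₀_of_mem_csp₀ Y (T.mem_ncsp₀_of_precsim Y hS hma ha)
    (T.mem_csp₀_of_precsim Y hS (hmm'.trans hm'c) hc))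

end DivisorMonoids

/-! ### The realified data `ofRlfZ`: the non-cuspidal and cuspidal prime sets are disjoint -/

namespace RealifiedDivisorMonoids

variable {D₀ : Type u₀} [Category.{v₀} D₀] (dm : DivisorMonoids.{u₀, v₀, w} D₀)
  (hpf : ∀ Y : D₀ᵒᵖ, IsPerfFactorial (dm.Φ₀.obj Y))

/-- For `ofRlfZ dm hpf` the sets of non-cuspidal and of cuspidal primes of `Φ₀(Y)` are disjoint (the input
`hdisj` of abc-iut-L6-t12's `ofRlfZ_ncspR_inf_cspR_eq_bot`, DISCHARGED). [cite: MochizukiEtTh2009, Def 3.6 p.77] -/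
theorem ofRlfZ_disjoint_toRSuppOf (Y : D₀ᵒᵖ) :
    Disjoint (toRSuppOf dm hpf Y (dm.ncsp₀ Y)) (toRSuppOf dm hpf Y (dm.csp₀ Y)) :=
  (disjoint_toRSuppOf_iff dm hpf Y _ _).2 fun _ ha _ hc =>
    dm.disjoint_supp_of_mem_ncsp₀_of_mem_csp₀ Y (hpf Y) ha hc

/-- Hence `Φ₀^ℝ(Y)^ncsp ⊓ Φ₀^ℝ(Y)^csp = 1` for `ofRlfZ`, unconditionally. [cite: MochizukiEtTh2009, Def 3.6 p.77] -/
theorem ofRlfZ_ncspR_inf_cspR (Y : D₀ᵒᵖ) : (ofRlfZ dm hpf).ncspR Y ⊓ (ofRlfZ dm hpf).cspR Y = ⊥ :=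
  ofRlfZ_ncspR_inf_cspR_eq_bot dm hpf Y (ofRlfZ_disjoint_toRSuppOf dm hpf Y)

end RealifiedDivisorMonoids

/-! ### Tempered Frobenioids over `ofRlfZ`: the data axioms of `cor38_iii_of` -/

namespace TemperedFrobenioid

variable {D₀ : Type u₀} [Category.{v₀} D₀] {dm : DivisorMonoids.{u₀, v₀, w} D₀}
  {hpf : ∀ Y : D₀ᵒᵖ, IsPerfFactorial (dm.Φ₀.obj Y)}
  {D : Type u} [Category.{v} D] {VD : FrdICatStub.{u, v, w} D}
  (C : TemperedFrobenioid (RealifiedDivisorMonoids.ofRlfZ dm hpf) D VD)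

/-- Unfolding: over `ofRlfZ`, `x ∈ Φ(A)` is non-cuspidal iff its support (in `Φ₀(Y_A)^rlf_factor`) consists
of non-cuspidal primes. [cite: MochizukiEtTh2009, Def 3.6 p.77] -/
theorem isNonCuspidal_iff_supp {A : Dᵒᵖ} (x : C.Φ.carrier A) :
    C.IsNonCuspidal x ↔ supp ((hpf (C.baseOp A)).realification.subtype (x : C.ΦRlog.obj A)) ⊆
      RealifiedDivisorMonoids.toRSuppOf dm hpf (C.baseOp A) (dm.ncsp₀ (C.baseOp A)) :=
  Iff.rfl

/-- Unfolding: over `ofRlfZ`, `x ∈ Φ(A)` is cuspidal iff its support consists of cuspidal primes.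
[cite: MochizukiEtTh2009, Def 3.6 p.77] -/
theorem isCuspidal_iff_supp {A : Dᵒᵖ} (x : C.Φ.carrier A) :
    C.IsCuspidal x ↔ supp ((hpf (C.baseOp A)).realification.subtype (x : C.ΦRlog.obj A)) ⊆
      RealifiedDivisorMonoids.toRSuppOf dm hpf (C.baseOp A) (dm.csp₀ (C.baseOp A)) :=
  Iff.rfl

/-- **(`hDa`) An element of `Φ(A)` that is both non-cuspidal and cuspidal is trivial** — DISCHARGED over
`ofRlfZ`. [cite: MochizukiEtTh2009, Def 3.6 p.77] -/
theorem eq_one_of_isNonCuspidal_of_isCuspidal {A : Dᵒᵖ} (x : C.Φ.carrier A) (hn : C.IsNonCuspidal x)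
    (hc : C.IsCuspidal x) : x = 1 := by
  have h1 : ((x : C.ΦRlog.obj A) : (hpf (C.baseOp A)).Rlf) = 1 :=
    RealifiedDivisorMonoids.ofRlfZ_eq_one_of_mem_ncspR_of_mem_cspR dm hpf (C.baseOp A)
      (RealifiedDivisorMonoids.ofRlfZ_disjoint_toRSuppOf dm hpf _) hn hc
  exact Subtype.ext h1

/-- `y ≼ x` in `Φ(A)` gives `y ∣ x^n` in `Φ^{ℝ-log}(A)` for some `n ≥ 1`. [cite: MochizukiEtTh2009, Def 3.6 p.77] -/
theorem exists_dvd_pow_of_precsim {A : Dᵒᵖ} {x y : C.Φ.carrier A} (h : Precsim y x) :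
    ∃ n : ℕ, n ≠ 0 ∧ ((C.Φ.carrier A).subtype y : (hpf (C.baseOp A)).Rlf) ∣
      ((C.Φ.carrier A).subtype x : (hpf (C.baseOp A)).Rlf) ^ n := by
  obtain ⟨n, hn, hyx⟩ := h
  refine ⟨n, hn.ne', ?_⟩
  rw [← map_pow]
  exact map_dvd _ hyx

/-- **(`hDn`, ⇒) Non-cuspidality descends along `≼`**: if `x ∈ Φ(A)` is non-cuspidal and `y ≼ x` in `Φ(A)`,
then `y` is non-cuspidal (down- and root-closedness of `Φ₀^ℝ(Y)^ncsp`, abc-iut-L6-t12).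
[cite: MochizukiEtTh2009, Def 3.6 p.77] -/
theorem isNonCuspidal_of_precsim {A : Dᵒᵖ} {x y : C.Φ.carrier A} (hyx : Precsim y x)
    (hx : C.IsNonCuspidal x) : C.IsNonCuspidal y := by
  obtain ⟨n, hn, hdvd⟩ := C.exists_dvd_pow_of_precsim hyx
  exact RealifiedDivisorMonoids.ofRlfZ_ncspR_of_dvd dm hpf _ hdvd
    ((RealifiedDivisorMonoids.ofRlfZ_pow_mem_ncspR_iff dm hpf _ _ hn).2 hx)

/-- **(`hDc`, ⇒) Cuspidality descends along `≼`.** [cite: MochizukiEtTh2009, Def 3.6 p.77] -/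
theorem isCuspidal_of_precsim {A : Dᵒᵖ} {x y : C.Φ.carrier A} (hyx : Precsim y x)
    (hx : C.IsCuspidal x) : C.IsCuspidal y := by
  obtain ⟨n, hn, hdvd⟩ := C.exists_dvd_pow_of_precsim hyx
  exact RealifiedDivisorMonoids.ofRlfZ_cspR_of_dvd dm hpf _ hdvd
    ((RealifiedDivisorMonoids.ofRlfZ_pow_mem_cspR_iff dm hpf _ _ hn).2 hx)

/-- **(`hDn`) "`x` is non-cuspidal iff every primary `y ≼ x` of `Φ(A)` is"** — over `ofRlfZ`, from the
hypothesis (R3) "no phantom support": every prime in the support of `x` lies in the support of some primary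
`y ≼ x` of `Φ(A)`. [cite: MochizukiEtTh2009, Def 3.6 p.77] -/
theorem isNonCuspidal_iff_primaries_of_noPhantom {A : Dᵒᵖ}
    (hR3 : ∀ (x : C.Φ.carrier A) (𝔮 : Primes (Perfection (dm.Φ₀.obj (C.baseOp A)))),
      𝔮 ∈ supp ((hpf (C.baseOp A)).realification.subtype (x : C.ΦRlog.obj A)) →
        ∃ y : C.Φ.carrier A, IsPrimary y ∧ Precsim y x ∧
          𝔮 ∈ supp ((hpf (C.baseOp A)).realification.subtype (y : C.ΦRlog.obj A)))
    (x : C.Φ.carrier A) :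
    C.IsNonCuspidal x ↔ ∀ y : C.Φ.carrier A, IsPrimary y → Precsim y x → C.IsNonCuspidal y := by
  refine ⟨fun hx y _ hyx => C.isNonCuspidal_of_precsim hyx hx, fun h => ?_⟩
  rw [isNonCuspidal_iff_supp]
  intro 𝔮 h𝔮
  obtain ⟨y, hy, hyx, hy𝔮⟩ := hR3 x 𝔮 h𝔮
  exact (C.isNonCuspidal_iff_supp y).1 (h y hy hyx) hy𝔮

/-- **(`hDc`) "`x` is cuspidal iff every primary `y ≼ x` of `Φ(A)` is"** — over `ofRlfZ`, from (R3).
[cite: MochizukiEtTh2009, Def 3.6 p.77] -/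
theorem isCuspidal_iff_primaries_of_noPhantom {A : Dᵒᵖ}
    (hR3 : ∀ (x : C.Φ.carrier A) (𝔮 : Primes (Perfection (dm.Φ₀.obj (C.baseOp A)))),
      𝔮 ∈ supp ((hpf (C.baseOp A)).realification.subtype (x : C.ΦRlog.obj A)) →
        ∃ y : C.Φ.carrier A, IsPrimary y ∧ Precsim y x ∧
          𝔮 ∈ supp ((hpf (C.baseOp A)).realification.subtype (y : C.ΦRlog.obj A)))
    (x : C.Φ.carrier A) :
    C.IsCuspidal x ↔ ∀ y : C.Φ.carrier A, IsPrimary y → Precsim y x → C.IsCuspidal y := by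
  refine ⟨fun hx y _ hyx => C.isCuspidal_of_precsim hyx hx, fun h => ?_⟩
  rw [isCuspidal_iff_supp]
  intro 𝔮 h𝔮
  obtain ⟨y, hy, hyx, hy𝔮⟩ := hR3 x 𝔮 h𝔮
  exact (C.isCuspidal_iff_supp y).1 (h y hy hyx) hy𝔮

end TemperedFrobenioid

/-! ### Cor. 3.8 (iii) (pre-steps) for tempered Frobenioids over `ofRlfZ` data -/

section Cor38

variable {D₀ : Type u₀} [Category.{v₀} D₀] {dm : DivisorMonoids.{u₀, v₀, w} D₀}
  {hpf : ∀ Y : D₀ᵒᵖ, IsPerfFactorial (dm.Φ₀.obj Y)}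
  {D : Type u} [Category.{v} D] {VD : FrdICatStub.{u, v, w} D}
  {D₀' : Type u₀} [Category.{v₀} D₀'] {dm' : DivisorMonoids.{u₀, v₀, w} D₀'}
  {hpf' : ∀ Y : D₀'ᵒᵖ, IsPerfFactorial (dm'.Φ₀.obj Y)}
  {D' : Type u} [Category.{v} D'] {VD' : FrdICatStub.{u, v, w} D'}
  {C₁ : TemperedFrobenioid (RealifiedDivisorMonoids.ofRlfZ dm hpf) D VD}
  {C₂ : TemperedFrobenioid (RealifiedDivisorMonoids.ofRlfZ dm' hpf') D' VD'} (h : Cor38Hyp C₁ C₂)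

open TemperedFrobenioid

/-- **Cor. 3.8 (iii), pre-step clause, for tempered Frobenioids over the realified data `ofRlfZ`**: the
data axioms `hDa`, `hDn`, `hDc` of `cor38_iii_of` are discharged (the last two from (R3)); remaining named
inputs: [FrdI] Thm. 3.4 (ii)/(iii) and Thm. 4.2 (i) for `Ψ^{±1}` (`hpre`…`hfrob'`), abc-iut-L2-t3's datum
"base-field-theoretic ⇒ non-cuspidal" (`hD1`) and (R3) (`hR3`). [cite: MochizukiEtTh2009, Cor 3.8 p.81] -/
theorem cor38_iii_ofRlfZ
    (hpre : ∀ ⦃X Y : C₁.category⦄ (φ : X ⟶ Y),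
      PreFrobenioid.IsPreStep C₁.toElem φ → PreFrobenioid.IsPreStep C₂.toElem (h.Ψ.functor.map φ))
    (hpre' : ∀ ⦃X Y : C₂.category⦄ (φ : X ⟶ Y),
      PreFrobenioid.IsPreStep C₂.toElem φ → PreFrobenioid.IsPreStep C₁.toElem (h.Ψ.inverse.map φ))
    (hprim : ∀ ⦃X Y : C₁.category⦄ (φ : X ⟶ Y), PreFrobenioid.IsPrimaryPreStep C₁.toElem φ →
      PreFrobenioid.IsPrimaryPreStep C₂.toElem (h.Ψ.functor.map φ))
    (hprim' : ∀ ⦃X Y : C₂.category⦄ (φ : X ⟶ Y), PreFrobenioid.IsPrimaryPreStep C₂.toElem φ →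
      PreFrobenioid.IsPrimaryPreStep C₁.toElem (h.Ψ.inverse.map φ))
    (hfrob : ∀ ⦃X Y : C₁.category⦄ (φ : X ⟶ Y), PreFrobenioid.IsFrobeniusType C₁.toElem φ →
      PreFrobenioid.IsFrobeniusType C₂.toElem (h.Ψ.functor.map φ))
    (hfrob' : ∀ ⦃X Y : C₂.category⦄ (φ : X ⟶ Y), PreFrobenioid.IsFrobeniusType C₂.toElem φ →
      PreFrobenioid.IsFrobeniusType C₁.toElem (h.Ψ.inverse.map φ))
    (hD1₁ : ∀ (A : Dᵒᵖ) (y : C₁.Φ.carrier A), C₁.IsBaseFieldTheoreticDiv y → C₁.IsNonCuspidal y)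
    (hD1₂ : ∀ (A : D'ᵒᵖ) (y : C₂.Φ.carrier A), C₂.IsBaseFieldTheoreticDiv y → C₂.IsNonCuspidal y)
    (hR3₁ : ∀ (A : Dᵒᵖ) (x : C₁.Φ.carrier A) (𝔮 : Primes (Perfection (dm.Φ₀.obj (C₁.baseOp A)))),
      𝔮 ∈ supp ((hpf (C₁.baseOp A)).realification.subtype (x : C₁.ΦRlog.obj A)) →
        ∃ y : C₁.Φ.carrier A, IsPrimary y ∧ Precsim y x ∧
          𝔮 ∈ supp ((hpf (C₁.baseOp A)).realification.subtype (y : C₁.ΦRlog.obj A)))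
    (hR3₂ : ∀ (A : D'ᵒᵖ) (x : C₂.Φ.carrier A) (𝔮 : Primes (Perfection (dm'.Φ₀.obj (C₂.baseOp A)))),
      𝔮 ∈ supp ((hpf' (C₂.baseOp A)).realification.subtype (x : C₂.ΦRlog.obj A)) →
        ∃ y : C₂.Φ.carrier A, IsPrimary y ∧ Precsim y x ∧
          𝔮 ∈ supp ((hpf' (C₂.baseOp A)).realification.subtype (y : C₂.ΦRlog.obj A))) :
    Cor38_iii h :=
  cor38_iii_of h hpre hpre' hprim hprim' hfrob hfrob'
    hD1₁ (fun _ x => C₁.eq_one_of_isNonCuspidal_of_isCuspidal x)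
    (fun A x => C₁.isNonCuspidal_iff_primaries_of_noPhantom (hR3₁ A) x)
    (fun A x => C₁.isCuspidal_iff_primaries_of_noPhantom (hR3₁ A) x)
    hD1₂ (fun _ x => C₂.eq_one_of_isNonCuspidal_of_isCuspidal x)
    (fun A x => C₂.isNonCuspidal_iff_primaries_of_noPhantom (hR3₂ A) x)
    (fun A x => C₂.isCuspidal_iff_primaries_of_noPhantom (hR3₂ A) x)

/-- **Cor. 3.8 (iii), pre-step clause, over `ofRlfZ` data and FSM-type bases**: as `cor38_iii_ofRlfZ`, with
[FrdI] Thm. 3.4 (ii)/(iii) discharged by abc-iut-L1's FSM-type theorems (inputs `IsFrobenioid`, `IsOfFSMType`).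
[cite: MochizukiEtTh2009, Cor 3.8 p.81] -/
theorem cor38_iii_ofRlfZ_of_isOfFSMType
    (hF₁ : PreFrobenioid.IsFrobenioid C₁.toElem) (hF₂ : PreFrobenioid.IsFrobenioid C₂.toElem)
    (hD : IsOfFSMType D) (hD' : IsOfFSMType D')
    (hprim : ∀ ⦃X Y : C₁.category⦄ (φ : X ⟶ Y), PreFrobenioid.IsPrimaryPreStep C₁.toElem φ →
      PreFrobenioid.IsPrimaryPreStep C₂.toElem (h.Ψ.functor.map φ))
    (hprim' : ∀ ⦃X Y : C₂.category⦄ (φ : X ⟶ Y), PreFrobenioid.IsPrimaryPreStep C₂.toElem φ →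
      PreFrobenioid.IsPrimaryPreStep C₁.toElem (h.Ψ.inverse.map φ))
    (hD1₁ : ∀ (A : Dᵒᵖ) (y : C₁.Φ.carrier A), C₁.IsBaseFieldTheoreticDiv y → C₁.IsNonCuspidal y)
    (hD1₂ : ∀ (A : D'ᵒᵖ) (y : C₂.Φ.carrier A), C₂.IsBaseFieldTheoreticDiv y → C₂.IsNonCuspidal y)
    (hR3₁ : ∀ (A : Dᵒᵖ) (x : C₁.Φ.carrier A) (𝔮 : Primes (Perfection (dm.Φ₀.obj (C₁.baseOp A)))),
      𝔮 ∈ supp ((hpf (C₁.baseOp A)).realification.subtype (x : C₁.ΦRlog.obj A)) →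
        ∃ y : C₁.Φ.carrier A, IsPrimary y ∧ Precsim y x ∧
          𝔮 ∈ supp ((hpf (C₁.baseOp A)).realification.subtype (y : C₁.ΦRlog.obj A)))
    (hR3₂ : ∀ (A : D'ᵒᵖ) (x : C₂.Φ.carrier A) (𝔮 : Primes (Perfection (dm'.Φ₀.obj (C₂.baseOp A)))),
      𝔮 ∈ supp ((hpf' (C₂.baseOp A)).realification.subtype (x : C₂.ΦRlog.obj A)) →
        ∃ y : C₂.Φ.carrier A, IsPrimary y ∧ Precsim y x ∧
          𝔮 ∈ supp ((hpf' (C₂.baseOp A)).realification.subtype (y : C₂.ΦRlog.obj A))) :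
    Cor38_iii h :=
  cor38_iii_of_isOfFSMType h hF₁ hF₂ hD hD' hprim hprim'
    hD1₁ (fun _ x => C₁.eq_one_of_isNonCuspidal_of_isCuspidal x)
    (fun A x => C₁.isNonCuspidal_iff_primaries_of_noPhantom (hR3₁ A) x)
    (fun A x => C₁.isCuspidal_iff_primaries_of_noPhantom (hR3₁ A) x)
    hD1₂ (fun _ x => C₂.eq_one_of_isNonCuspidal_of_isCuspidal x)
    (fun A x => C₂.isNonCuspidal_iff_primaries_of_noPhantom (hR3₂ A) x)
    (fun A x => C₂.isCuspidal_iff_primaries_of_noPhantom (hR3₂ A) x)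

end Cor38

end Literature.AnabelianGeometry.EtaleTheta
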